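import Summits.AtomisticToContinuum.Crystallization.Theorems.FrustratedLawDichotomyAveragingRuleUnsplit

/-!
# FrustratedLawDichotomy · the cap is INVISIBLE on dense balls: census numbers for `LAP` ARE numbers for `LAP^D` (concordance lemmas)

`…AveragingRuleCap` replaced lens-5's uncapped flags `GoodAt η` by the capped `GoodAtScale η D` to make the averaging rule local
(`…GoodFlagNonlocal`: the uncapped rule is not).  Census TAG 181-S(iii)-AVG (critic row 518 (4)) measures lens-5's UNCAPPED ball averages
`S_i` on embedded cores.  This DEF-FREE file records that the two objects COINCIDE wherever the census looks:

* §1 at a site with a neighbour within `D` the capped flag is the uncapped flag (`goodFlag_eq_of_nearestDist_le`, via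
  `…MotifLemmas.goodAtScale_iff`), so `surplusCap = surplus` there (`surplusCap_eq_surplus_of_nearestDist_le`) and on a `D`-DENSE ball
  (every site of `B(i,ρ)` has a neighbour within `D`) `S^D_i = S_i`, `TightNearCap ↔ TightNear`, `BadNearCap ↔ BadNear`
  (`ballAvg_surplusCap_eq_of_dense`, `tightNearCap_iff_of_dense`, `badNearCap_iff_of_dense`);
* §2 AUTOMATIC DENSITY: two sites of one `ρ`-ball are within `2ρ` of each other, so for `D ≥ 2ρ` every ball with at least two sites is
  `D`-dense (`dense_of_two_le_card`): with `D = 2ρ` the capped and uncapped ball averages differ ONLY on singleton balls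
  (`ballAvg_surplusCap_eq_of_two_le_card`), and at the one-shell radius `ρ = 23/20` the choice `D = 23/10` keeps the locality radius
  `13/10·D + 1 = 3.99 ≤ 9/2 = ρ₁` inside the range of `W₄₅` — literal node `aperiodicFrustratedLawGap_fourHalf_of_tightFreeMotifCap_unsplit_oneShell'`
  (`ρ = 23/20`, `D = 23/10`, `ϱ = 113/20`): on every non-singleton ball its motif inequality is EXACTLY lens-5's uncapped `S_i(0) ≥ 0`.

[folklore] bookkeeping; 0 sorry; DEF-FREE.  Prover hand 2, gen 13 (decomp-a2c), `--supports stmt-AtomisticToContinuum-27623`.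
-/

noncomputable section

namespace Summit.AtomisticToContinuum.Crystallization.Theorems.FrustratedLawDichotomyAveragingRuleDense

open scoped BigOperators Classical
open Literature.Geometry.DiscreteGeometry (nearestDist nearestDist_le_dist)
open Literature.MathematicalPhysics.StatisticalMechanics (siteEnergy)
open Summit.AtomisticToContinuum.Crystallization.Theorems.ChargedEnergyGapNegative (E3)
open Summit.AtomisticToContinuum.Crystallization.Theorems.FrustratedLawDichotomyRangeCut
open Summit.AtomisticToContinuum.Crystallization.Theorems.FrustratedLawDichotomySchurCut
open Summit.AtomisticToContinuum.Crystallization.Theorems.FrustratedLawDichotomyMotifLemmas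
open Summit.AtomisticToContinuum.Crystallization.Theorems.FrustratedLawDichotomyRuleToolkit
open Summit.AtomisticToContinuum.Crystallization.Theorems.FrustratedLawDichotomyRuleToolkitGood
open Summit.AtomisticToContinuum.Crystallization.Theorems.FrustratedLawDichotomyAveragingCut
  (surplus ball ballAvg mem_ball TightNear BadNear)
open Summit.AtomisticToContinuum.Crystallization.Theorems.FrustratedLawDichotomyAveragingRule
open Summit.AtomisticToContinuum.Crystallization.Theorems.FrustratedLawDichotomyAveragingRuleCap
open Summit.AtomisticToContinuum.Crystallization.Theorems.FrustratedLawDichotomyAveragingRuleTightFree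
open Summit.AtomisticToContinuum.Crystallization.Theorems.FrustratedLawDichotomyAveragingRuleUnsplit

/-! ## §1. The cap is invisible at a site with a neighbour within `D` -/

/-- At a site with a neighbour within `D` (injective cluster), `GoodAtScale η D ↔ GoodAt η`. [folklore] -/
theorem goodAtScale_iff_goodAt_of_nearestDist_le {η D : ℝ} {N : ℕ} {y : Fin N → E3} (hy : Function.Injective y) {j : Fin N}
    (hj : nearestDist y j ≤ D) : GoodAtScale η D y j ↔ GoodAt η y j := by
  rw [goodAtScale_iff hy]
  exact ⟨fun h => h.1, fun h => ⟨h, hj⟩⟩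

/-- Hence the capped flag is the uncapped flag there. [folklore] -/
theorem goodFlag_eq_of_nearestDist_le {η D : ℝ} {N : ℕ} {y : Fin N → E3} (hy : Function.Injective y) {j : Fin N}
    (hj : nearestDist y j ≤ D) : goodFlag η D N y j = if GoodAt η y j then (1 : ℝ) else 0 := by
  unfold goodFlag
  by_cases h : GoodAt η y j
  · rw [if_pos h, if_pos ((goodAtScale_iff_goodAt_of_nearestDist_le hy hj).2 h)]
  · rw [if_neg h, if_neg (fun h' => h ((goodAtScale_iff_goodAt_of_nearestDist_le hy hj).1 h'))]

/-- ★ **`surplusCap = surplus` at a site with a neighbour within `D`.** [folklore] -/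
theorem surplusCap_eq_surplus_of_nearestDist_le {η₀ η₁ D : ℝ} {W : ℝ → ℝ} {e κT CT : ℝ} {N : ℕ} {y : Fin N → E3}
    (hy : Function.Injective y) {j : Fin N} (hj : nearestDist y j ≤ D) :
    surplusCap η₀ η₁ D W e κT CT N y j = surplus η₀ η₁ W e κT CT y j := by
  unfold surplusCap surplus pairSumFeature
  rw [goodFlag_eq_of_nearestDist_le hy hj, goodFlag_eq_of_nearestDist_le hy hj, siteEnergy_eq]

/-- ★ **On a `D`-dense ball, `S^D_i = S_i`** (capped and uncapped ball averages agree). [folklore] -/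
theorem ballAvg_surplusCap_eq_of_dense {ρ η₀ η₁ D : ℝ} {W : ℝ → ℝ} {e κT CT : ℝ} {N : ℕ} {y : Fin N → E3} (hy : Function.Injective y)
    {i : Fin N} (hdense : ∀ j ∈ ball ρ y i, nearestDist y j ≤ D) :
    ballAvg ρ y (surplusCap η₀ η₁ D W e κT CT N y) i = ballAvg ρ y (surplus η₀ η₁ W e κT CT y) i := by
  unfold ballAvg
  exact Finset.sum_congr rfl fun j hj => by rw [surplusCap_eq_surplus_of_nearestDist_le hy (hdense j hj)]

/-- On a `D`-dense ball the capped and uncapped TIGHT regimes agree. [folklore] -/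
theorem tightNearCap_iff_of_dense {ρ D : ℝ} {N : ℕ} {y : Fin N → E3} (hy : Function.Injective y) {i : Fin N}
    (hdense : ∀ j ∈ ball ρ y i, nearestDist y j ≤ D) : TightNearCap ρ D y i ↔ TightNear ρ y i :=
  ⟨fun ⟨j, hj, hg⟩ => ⟨j, hj, hg.goodAt⟩, fun ⟨j, hj, hg⟩ => ⟨j, hj, (goodAtScale_iff_goodAt_of_nearestDist_le hy (hdense j hj)).2 hg⟩⟩

/-- On a `D`-dense ball the capped and uncapped BAD regimes agree. [folklore] -/
theorem badNearCap_iff_of_dense {ρ D : ℝ} {N : ℕ} {y : Fin N → E3} (hy : Function.Injective y) {i : Fin N}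
    (hdense : ∀ j ∈ ball ρ y i, nearestDist y j ≤ D) : BadNearCap ρ D y i ↔ BadNear ρ y i :=
  ⟨fun ⟨j, hj, hb⟩ => ⟨j, hj, fun hg => hb ((goodAtScale_iff_goodAt_of_nearestDist_le hy (hdense j hj)).2 hg)⟩,
    fun ⟨j, hj, hb⟩ => ⟨j, hj, fun hg => hb hg.goodAt⟩⟩

/-- ★ **Pointwise concordance**: on a `D`-dense ball, `LAP^D` at `i` ⟺ `LAP` at `i`. [folklore] -/
theorem lapCap_iff_lap_of_dense {ρ η₀ η₁ D : ℝ} {W : ℝ → ℝ} {e κT CT : ℝ} {N : ℕ} {y : Fin N → E3} (hy : Function.Injective y)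
    {i : Fin N} (hdense : ∀ j ∈ ball ρ y i, nearestDist y j ≤ D) :
    0 ≤ ballAvg ρ y (surplusCap η₀ η₁ D W e κT CT N y) i ↔ 0 ≤ ballAvg ρ y (surplus η₀ η₁ W e κT CT y) i := by
  rw [ballAvg_surplusCap_eq_of_dense hy hdense]

/-! ## §2. Automatic density: `D ≥ 2ρ` -/

/-- Two sites of one `ρ`-ball are within `2ρ` of each other, so each has nearest-neighbour distance `≤ 2ρ`. [folklore] -/
theorem nearestDist_le_of_mem_ball {ρ : ℝ} {N : ℕ} {y : Fin N → E3} {i j k : Fin N} (hj : j ∈ ball ρ y i) (hk : k ∈ ball ρ y i)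
    (hjk : k ≠ j) : nearestDist y j ≤ 2 * ρ := by
  rw [mem_ball] at hj hk
  calc nearestDist y j ≤ dist (y j) (y k) := nearestDist_le_dist y hjk
    _ ≤ dist (y j) (y i) + dist (y i) (y k) := dist_triangle _ _ _
    _ ≤ ρ + ρ := add_le_add hj (by rw [dist_comm]; exact hk)
    _ = 2 * ρ := by ring

/-- ★ For `D ≥ 2ρ`, every ball with at least two sites is `D`-dense. [folklore] -/
theorem dense_of_two_le_card {ρ D : ℝ} (hD : 2 * ρ ≤ D) {N : ℕ} {y : Fin N → E3} {i : Fin N} (hcard : 2 ≤ (ball ρ y i).card) :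
    ∀ j ∈ ball ρ y i, nearestDist y j ≤ D := by
  intro j hj
  have h1 : 1 < (ball ρ y i).card := hcard
  obtain ⟨k, hk, hkj⟩ := Finset.exists_mem_ne h1 j
  exact (nearestDist_le_of_mem_ball hj hk hkj).trans hD

/-- ★ **With `D ≥ 2ρ` the capped and uncapped ball averages differ only on singleton balls.** [folklore] -/
theorem ballAvg_surplusCap_eq_of_two_le_card {ρ η₀ η₁ D : ℝ} {W : ℝ → ℝ} {e κT CT : ℝ} (hD : 2 * ρ ≤ D) {N : ℕ} {y : Fin N → E3}
    (hy : Function.Injective y) {i : Fin N} (hcard : 2 ≤ (ball ρ y i).card) :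
    ballAvg ρ y (surplusCap η₀ η₁ D W e κT CT N y) i = ballAvg ρ y (surplus η₀ η₁ W e κT CT y) i :=
  ballAvg_surplusCap_eq_of_dense hy (dense_of_two_le_card hD hcard)

/-- **One-shell literal with the cap invisible on non-singleton balls**: `ρ = 23/20`, `D = 23/10 = 2ρ`, `ρ₁ = 9/2` (`13/10·D + 1 = 3.99 ≤ 9/2`),
`ϱ = 113/20`; unsplit feed (no elastic piece, no surcharge). [folklore chaining] -/
theorem aperiodicFrustratedLawGap_fourHalf_of_tightFreeMotifCap_unsplit_oneShell'
    (hDoor : Summit.AtomisticToContinuum.Crystallization.Theses.GrainCoreNetworkSplit.MuEquilibriumDoor)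
    (hSF : SF₄₅) (hU : PeriodicEnergyCeiling (-(7175 / 10000)))
    (h : TightFreeMotifPricingCapAt 0 (23 / 20) (113 / 20) (23 / 10) (effPot w₄₅ ω₄ (3 / 400)) (-(7174 / 10000) + 3 / 400)) :
    Summit.AtomisticToContinuum.Crystallization.Theses.FrustratedLawDichotomy.AperiodicFrustratedLawGap :=
  aperiodicFrustratedLawGap_fourHalf_of_tightFreeMotifCap_unsplit (ρ₁ := 9 / 2) hDoor hSF hU (by norm_num) (by norm_num) le_rfl (by norm_num)
    (by norm_num) h

/-- On a non-singleton one-shell ball the `D = 2ρ` motif inequality of the literal node is EXACTLY lens-5's uncapped `S_c(0) ≥ 0`. [folklore] -/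
theorem oneShell_motif_ineq_iff_uncapped {M : ℕ} {z : Fin M → E3} (hz : Function.Injective z) {c : Fin M}
    (hcard : 2 ≤ (ball (23 / 20) z c).card) :
    0 ≤ ballAvg (23 / 20) z (surplusCap (1 / 20) (1 / 8) (23 / 10) (effPot w₄₅ ω₄ (3 / 400)) (-(7174 / 10000) + 3 / 400) 0 0 M z) c ↔
      0 ≤ ballAvg (23 / 20) z (surplus (1 / 20) (1 / 8) (effPot w₄₅ ω₄ (3 / 400)) (-(7174 / 10000) + 3 / 400) 0 0 z) c := by
  rw [ballAvg_surplusCap_eq_of_two_le_card (by norm_num) hz hcard]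

end Summit.AtomisticToContinuum.Crystallization.Theorems.FrustratedLawDichotomyAveragingRuleDense

end
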